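import Summits.AtomisticToContinuum.Crystallization.Theorems.PalmUnimodularRigidityMinimiserShellsPricingContainment
import Summits.AtomisticToContinuum.Crystallization.Theorems.PalmUnimodularRigidityMinimiserShellsNecessityBlocks
import Summits.AtomisticToContinuum.Crystallization.Theorems.PalmUnimodularRigidityMinimiserShellsResidualDefs

/-!
# Linear pricing of a radius-`2` local shell predicate is a periodic crystallization theorem
(stub `stub_pricingToPeriodic`, line `octahedral-annulus-mandate`)

Stub `stub_pricingToPeriodic` of line `octahedral-annulus-mandate` of crux `MinimiserShells`
(stmt-AtomisticToContinuum-9225, route `PalmUnimodularRigidity`).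

This is `PricingContainment.le_energyPerParticle_of_pricing` with the locality radius `5/4` replaced by `2`:
let `G` be a predicate of measures on `ℝ³` that is LOCAL at radius `2` (two measures with the same atoms in the
closed ball `B̄(0, 2)` get the same verdict) and suppose the certificate `e* + c · P{μ | ¬ G μ} ≤ E_P[h]` holds
for every point-stationary, almost surely `1/3`-hard-core probability law `P`, with `c > 0`.  Then every
periodic configuration `Q` of `ℝ³` with `1/3`-separated points in which at least `t · #motif` motif sites `x`
fail `G` (read in `Q.points` re-rooted at `x`, `rerooted Q x`) has `e* + c · t ≤ e(Q)`.

Proof: exactly the one of `PricingContainment`, run one layer deeper in the block.  A block point of the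
`K³`-block `blockConfig Q K` of `Q` whose lattice coordinates are `depth Q 3`-deep sees every point of `Q`
within distance `5/2` as a block point (`points_inter_closedBall_subset_range`,
`Blocks.exists_eq_toP_of_dist_lt` at `ρ = 3`), and sees the re-rooted point set of its motif site
(`PeriodicShellGapConverse.image_sub_bpt_points`), so by radius-`2` locality (`R₀ = 5/2 ≥ 2`,
`congr_count_restrict_image_sub_of_local`) it fails `G` in the block iff its motif site fails `G` in
`Q.points` (`block_iff`); hence `#bad(block) ≥ #deep · #bad(F) ≥ (K³ − 6·depth·K²) · t · #F ≥ (t − ε) · #F·K³`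
for `K` large (`card_bad_block_ge`, `Blocks.card_deep_ge`, `exists_blocks`).  The certificate applied to the
uniformly rooted law of the block (`Negative.UniformRooting`: point-stationary, a.s. `1/3`-hard-core,
`E_P[h] = 𝓔_N/N ≤ e(Q) + ε`), together with `PricingContainment.natCard_le_mul_unifRooted_apply`
(`t − ε ≤ P{¬ G}`), gives `e* + c·(t − ε) ≤ e(Q) + ε`; let `ε → 0` (`le_energyPerParticle_of_pricing`).
Nothing here is a published fact; these are elementary consequences of files already in `Theorems/`.
-/

noncomputable section

open MeasureTheory
open scoped ENNReal BigOperators Classical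

namespace Summit.AtomisticToContinuum.Crystallization.Theorems.PalmUnimodularRigidityMinimiserShells.PricingToPeriodic

open Literature.Probability.Process (IsRootedHardCore IsPointStationaryLaw)
open Literature.MathematicalPhysics.StatisticalMechanics (lennardJones interactionEnergy PeriodicConfiguration)
open Summit.AtomisticToContinuum.Crystallization.Theorems.MinimiserShells.Negative.LoadBearing (eStar meanRootEnergy)
open Summit.AtomisticToContinuum.Crystallization.Theorems.MinimiserShells.Negative.Rootedness (E3)
open Summit.AtomisticToContinuum.Crystallization.Theorems.MinimiserShells.Negative.UniformRooting
  (rootedMeasure unifRooted rootedMeasure_eq_range isProbabilityMeasure_unifRooted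
   isPointStationaryLaw_unifRooted ae_isRootedHardCore_unifRooted meanRootEnergy_unifRooted)
open Summit.AtomisticToContinuum.Crystallization.Theorems.PalmUnimodularRigidityMinimiserShells.Residual
  (ShellGap IsSepThird looseBadMotifCount rerooted)
open Summit.AtomisticToContinuum.Crystallization.Theorems.PalmUnimodularRigidityMinimiserShells.ShellNoBoundary
  (count_restrict_image_sub_singleton_ne_zero_iff)
open Summit.AtomisticToContinuum.Crystallization.Theorems.ChargedEnergyGapNegative.Blocks
  (BIdx bpt toP card_BIdx blockConfig blockConfig_apply blockConfig_injective IsDeep depth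
   exists_eq_toP_of_dist_lt exists_block_energy_le card_deep_ge)
open Summit.AtomisticToContinuum.Crystallization.Theorems.PalmUnimodularRigidity.LayeredLawsSelectHcp
  (range_blockConfig_subset bpt_mem_range_blockConfig)
open Summit.AtomisticToContinuum.Crystallization.Theorems.PalmUnimodularRigidityMinimiserShells.PeriodicShellGapConverse
  (image_sub_bpt_points)
open Summit.AtomisticToContinuum.Crystallization.Theorems.PalmUnimodularRigidityMinimiserShells.PricingContainment
  (natCard_le_mul_unifRooted_apply)

/-! ## Radius-`2` local shell predicates -/

/-- **Deep sites see the same radius-`2` local verdict in `S` and in the window.**  Let `G` be a predicate of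
measures on `ℝ³` that is local at radius `2` (two measures with the same atoms in `B̄(0, 2)` get the same
verdict).  If `C ⊆ S` contains every point of `S` within distance `R₀ ≥ 2` of `y`, then the re-rooted counting
measures `count|((· - y) '' S)` and `count|((· - y) '' C)` get the same verdict. -/
theorem congr_count_restrict_image_sub_of_local {G : Measure E3 → Prop}
    (hloc : ∀ {μ ν : Measure E3}, (∀ w : E3, ‖w‖ ≤ 2 → (μ {w} ≠ 0 ↔ ν {w} ≠ 0)) → (G μ ↔ G ν))
    {S C : Set E3} (hCS : C ⊆ S) {y : E3} {R₀ : ℝ} (hR₀ : 2 ≤ R₀)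
    (hdeep : S ∩ Metric.closedBall y R₀ ⊆ C) :
    G ((Measure.count : Measure E3).restrict ((fun z => z - y) '' S)) ↔
      G ((Measure.count : Measure E3).restrict ((fun z => z - y) '' C)) := by
  refine hloc fun w hw => ?_
  rw [count_restrict_image_sub_singleton_ne_zero_iff, count_restrict_image_sub_singleton_ne_zero_iff]
  refine ⟨fun hS => hdeep ⟨hS, ?_⟩, fun hC => hCS hC⟩
  rw [Metric.mem_closedBall, dist_eq_norm, add_sub_cancel_right]
  exact hw.trans hR₀

/-! ## Deep block points are `5/2`-deep in the block -/

/-- **Deep block points are `5/2`-deep in the block**: if the lattice coordinates of the block point `u` are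
`depth Q 3`-deep, every point of `Q` within distance `5/2` of it is a block point
(`Blocks.exists_eq_toP_of_dist_lt` at `ρ = 3`). -/
theorem points_inter_closedBall_subset_range (Q : PeriodicConfiguration 3) (K : ℕ) {u : BIdx Q K}
    (hdeep : IsDeep K (depth Q 3) u.2) :
    Q.points ∩ Metric.closedBall (bpt Q K u) (5 / 2) ⊆ Set.range (blockConfig Q K) := by
  rintro p ⟨hp, hball⟩
  by_cases hpu : p = bpt Q K u
  · rw [hpu]
    exact bpt_mem_range_blockConfig Q K u
  · have hne : (⟨p, hp⟩ : Q.points) ≠ toP Q K u := fun h => hpu (congrArg Subtype.val h)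
    have hlt : dist (bpt Q K u) p < 3 := by
      rw [Metric.mem_closedBall, dist_comm] at hball
      linarith
    obtain ⟨v, -, hv⟩ := exists_eq_toP_of_dist_lt Q K hdeep ⟨p, hp⟩ hne hlt
    have hpv : bpt Q K v = p := congrArg Subtype.val hv
    rw [← hpv]
    exact bpt_mem_range_blockConfig Q K v

/-! ## Local verdicts at deep block points -/

/-- **Deep block points get the verdict of their motif point.**  For a radius-`2` local predicate `G` and
`depth Q 3`-deep lattice coordinates `k`, the block point `x + latVec (coords k)` re-rooted in the finite block
configuration gets the same verdict as the motif point `x` re-rooted in the infinite point set `Q.points`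
(locality with `R₀ = 5/2`, `points_inter_closedBall_subset_range`, and lattice invariance
`PeriodicShellGapConverse.image_sub_bpt_points`). -/
theorem block_iff {G : Measure E3 → Prop}
    (hloc : ∀ {μ ν : Measure E3}, (∀ w : E3, ‖w‖ ≤ 2 → (μ {w} ≠ 0 ↔ ν {w} ≠ 0)) → (G μ ↔ G ν))
    (Q : PeriodicConfiguration 3) (K : ℕ) (x : Q.motif) {k : Fin 3 → Fin K}
    (hdeep : IsDeep K (depth Q 3) k) :
    G ((Measure.count : Measure E3).restrict
        ((fun z => z - bpt Q K (x, k)) '' Set.range (blockConfig Q K))) ↔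
      G ((Measure.count : Measure E3).restrict ((fun z => z - (x : E3)) '' Q.points)) := by
  rw [← image_sub_bpt_points Q K (x, k)]
  exact (congr_count_restrict_image_sub_of_local hloc (range_blockConfig_subset Q K)
    (by norm_num : (2 : ℝ) ≤ 5 / 2)
    (points_inter_closedBall_subset_range Q K (u := (x, k)) hdeep)).symm

/-- **Deep coordinates × bad motif sites inject into the bad block indices** (for a radius-`2` local predicate
`G`): `#{k deep} · #{x ∈ F with ¬ G at x in Q.points} ≤ #{a with ¬ G at a in the block}`
(`(k, x) ↦ equivFin (x, k)`, `block_iff`). -/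
theorem card_bad_block_ge {G : Measure E3 → Prop}
    (hloc : ∀ {μ ν : Measure E3}, (∀ w : E3, ‖w‖ ≤ 2 → (μ {w} ≠ 0 ↔ ν {w} ≠ 0)) → (G μ ↔ G ν))
    (Q : PeriodicConfiguration 3) (K : ℕ) :
    Nat.card {k : Fin 3 → Fin K // IsDeep K (depth Q 3) k} *
        Nat.card {x : Q.motif // ¬ G ((Measure.count : Measure E3).restrict
          ((fun z => z - (x : E3)) '' Q.points))} ≤
      Nat.card {a : Fin (Fintype.card (BIdx Q K)) // ¬ G ((Measure.count : Measure E3).restrict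
          ((fun z => z - blockConfig Q K a) '' Set.range (blockConfig Q K)))} := by
  let f : {k : Fin 3 → Fin K // IsDeep K (depth Q 3) k} ×
      {x : Q.motif // ¬ G ((Measure.count : Measure E3).restrict
          ((fun z => z - (x : E3)) '' Q.points))} →
      {a : Fin (Fintype.card (BIdx Q K)) // ¬ G ((Measure.count : Measure E3).restrict
          ((fun z => z - blockConfig Q K a) '' Set.range (blockConfig Q K)))} :=
    fun p => ⟨Fintype.equivFin (BIdx Q K) (p.2.1, p.1.1), by
      rw [blockConfig_apply, Equiv.symm_apply_apply, block_iff hloc Q K p.2.1 p.1.2]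
      exact p.2.2⟩
  have hf : Function.Injective f := by
    rintro ⟨⟨k, _⟩, ⟨x, _⟩⟩ ⟨⟨k', _⟩, ⟨x', _⟩⟩ h
    have h' : Fintype.equivFin (BIdx Q K) (x, k) = Fintype.equivFin (BIdx Q K) (x', k') :=
      congrArg Subtype.val h
    obtain ⟨rfl, rfl⟩ := Prod.ext_iff.1 ((Fintype.equivFin (BIdx Q K)).injective h')
    rfl
  have := Nat.card_le_card_of_injective f hf
  rwa [Nat.card_prod] at this

/-! ## Blocks with many bad sites -/

/-- **Blocks of a hard-core periodic configuration with many bad motif sites** (for a radius-`2` local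
predicate `G`).  If `Q.points` is `1/3`-separated and at least `t · #F` motif sites `x` have `¬ G` at the
re-rooted point set `count|((· - x) '' Q.points)`, then for every `ε > 0` some block `blockConfig Q K` is a
finite injective `1/3`-separated configuration `y : Fin N → ℝ³`, `N = #F·K³ > 0`, with
`𝓔_N(y) ≤ N · (e(Q) + ε)` (`Blocks.exists_block_energy_le`) and at least `(t − ε) · N` indices `i` with
`¬ G` at `count|((· - y i) '' range y)` (`card_bad_block_ge`, `Blocks.card_deep_ge` at depth `depth Q 3`,
`K` large). -/
theorem exists_blocks {G : Measure E3 → Prop}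
    (hloc : ∀ {μ ν : Measure E3}, (∀ w : E3, ‖w‖ ≤ 2 → (μ {w} ≠ 0 ↔ ν {w} ≠ 0)) → (G μ ↔ G ν))
    (Q : PeriodicConfiguration 3)
    (hsep : ∀ p ∈ Q.points, ∀ q ∈ Q.points, p ≠ q → (1 : ℝ) / 3 ≤ dist p q) (t : ℝ)
    (hbad : t * (Q.motif.card : ℝ) ≤ (Nat.card {x : Q.motif //
      ¬ G ((Measure.count : Measure E3).restrict ((fun z => z - (x : E3)) '' Q.points))} : ℝ))
    {ε : ℝ} (hε : 0 < ε) :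
    ∃ N : ℕ, 0 < N ∧ ∃ y : Fin N → E3, Function.Injective y ∧
      (∀ i j : Fin N, i ≠ j → (1 : ℝ) / 3 ≤ dist (y i) (y j)) ∧
      interactionEnergy lennardJones y ≤ (N : ℝ) * (Q.energyPerParticle lennardJones + ε) ∧
      (t - ε) * (N : ℝ) ≤ (Nat.card {i : Fin N //
        ¬ G ((Measure.count : Measure E3).restrict ((fun z => z - y i) '' Set.range y))} : ℝ) := by
  have hF : (0 : ℝ) < Q.motif.card := by exact_mod_cast Q.motif_nonempty.card_pos
  -- blocks are trial states with slack `ε` per particle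
  obtain ⟨K₀, hK₀, hK⟩ := exists_block_energy_le Q hε
  -- a large `K`: beyond `K₀` and with `6 · depth · t ≤ ε · K`
  obtain ⟨K, hKK₀, hKt⟩ : ∃ K : ℕ, K₀ ≤ K ∧ 6 * (depth Q 3 : ℝ) * t / ε ≤ K :=
    ⟨max K₀ ⌈6 * (depth Q 3 : ℝ) * t / ε⌉₊, le_max_left _ _,
      (Nat.le_ceil _).trans (by exact_mod_cast le_max_right _ _)⟩
  have hKpos : 0 < K := lt_of_lt_of_le hK₀ hKK₀
  have hKr : (0 : ℝ) < K := by exact_mod_cast hKpos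
  have hn : ((Fintype.card (BIdx Q K) : ℕ) : ℝ) = Q.motif.card * (K : ℝ) ^ 3 := by
    exact_mod_cast card_BIdx Q K
  have hN : 0 < Fintype.card (BIdx Q K) := by
    rw [card_BIdx]
    exact mul_pos Q.motif_nonempty.card_pos (pow_pos hKpos 3)
  refine ⟨Fintype.card (BIdx Q K), hN, blockConfig Q K, blockConfig_injective Q K, fun i j hij => ?_,
    hK K hKK₀, ?_⟩
  · -- the separation is inherited from `Q.points`
    exact hsep _ (range_blockConfig_subset Q K ⟨i, rfl⟩) _ (range_blockConfig_subset Q K ⟨j, rfl⟩)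
      fun h => hij (blockConfig_injective Q K h)
  · -- the count of bad block indices
    rw [hn]
    set B := Nat.card {a : Fin (Fintype.card (BIdx Q K)) // ¬ G ((Measure.count : Measure E3).restrict
      ((fun z => z - blockConfig Q K a) '' Set.range (blockConfig Q K)))}
    have hB0 : (0 : ℝ) ≤ B := Nat.cast_nonneg _
    have hFK : (0 : ℝ) < Q.motif.card * (K : ℝ) ^ 3 := mul_pos hF (pow_pos hKr 3)
    by_cases ht : t ≤ ε
    · -- a nonpositive threshold is trivially met
      calc (t - ε) * (Q.motif.card * (K : ℝ) ^ 3) ≤ 0 * (Q.motif.card * (K : ℝ) ^ 3) :=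
            mul_le_mul_of_nonneg_right (by linarith) hFK.le
        _ = 0 := zero_mul _
        _ ≤ (B : ℝ) := hB0
    · push Not at ht
      have ht0 : 0 < t := hε.trans ht
      -- bad block indices: at least `#deep · #bad(F) ≥ (K³ − 6·d·K²) · t · #F`
      have hcnt := card_bad_block_ge hloc Q K
      have hdeep := card_deep_ge K (depth Q 3)
      set d := depth Q 3
      set D := Nat.card {k : Fin 3 → Fin K // IsDeep K d k}
      set M := Nat.card {x : Q.motif //
        ¬ G ((Measure.count : Measure E3).restrict ((fun z => z - (x : E3)) '' Q.points))}
      have h1 : (K : ℝ) ^ 3 - 6 * (d : ℝ) * (K : ℝ) ^ 2 ≤ (D : ℝ) := by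
        have := (Nat.cast_le (α := ℝ)).2 hdeep
        push_cast at this
        linarith
      have h2 : (D : ℝ) * (M : ℝ) ≤ (B : ℝ) := by exact_mod_cast hcnt
      have hD0 : (0 : ℝ) ≤ D := Nat.cast_nonneg _
      have h6 : 6 * (d : ℝ) * t ≤ ε * K := by
        rw [div_le_iff₀ hε] at hKt
        linarith
      have hFK2 : (0 : ℝ) ≤ Q.motif.card * (K : ℝ) ^ 2 := by positivity
      have h6' := mul_le_mul_of_nonneg_right h6 hFK2
      calc (t - ε) * (Q.motif.card * (K : ℝ) ^ 3)
          = t * Q.motif.card * (K : ℝ) ^ 3 - ε * K * (Q.motif.card * (K : ℝ) ^ 2) := by ring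
        _ ≤ t * Q.motif.card * (K : ℝ) ^ 3 - 6 * (d : ℝ) * t * (Q.motif.card * (K : ℝ) ^ 2) := by
            linarith
        _ = ((K : ℝ) ^ 3 - 6 * (d : ℝ) * (K : ℝ) ^ 2) * (t * Q.motif.card) := by ring
        _ ≤ (D : ℝ) * (t * Q.motif.card) := mul_le_mul_of_nonneg_right h1 (mul_nonneg ht0.le hF.le)
        _ ≤ (D : ℝ) * (M : ℝ) := mul_le_mul_of_nonneg_left hbad hD0
        _ ≤ (B : ℝ) := h2

/-! ## The containment theorem at radius `2` -/

/-- **Linear pricing of a radius-`2` local shell predicate is a periodic crystallization theorem for it.**  Let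
`G` be a predicate of measures on `ℝ³` that is local at radius `2` (two measures with the same atoms in
`B̄(0, 2)` get the same verdict) and suppose the certificate `e* + c · P{μ | ¬ G μ} ≤ E_P[h]` holds for every
point-stationary, almost surely `1/3`-hard-core probability law `P`, with `c > 0`.  Then every periodic
configuration `Q` of `ℝ³` with `1/3`-separated points in which at least `t · #motif` motif sites `x` fail `G`
(read in `Q.points` re-rooted at `x`) has `e* + c · t ≤ e(Q)`.  Proof: apply the certificate to the uniformly
rooted law of a `K³`-block of `Q` (`exists_blocks`, `Negative.UniformRooting`), whose energy is `≤ e(Q) + ε`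
per particle and whose bad fraction is `≥ t − ε` (`PricingContainment.natCard_le_mul_unifRooted_apply`), and
let `ε → 0`. -/
theorem le_energyPerParticle_of_pricing {G : Measure E3 → Prop}
    (hloc : ∀ {μ ν : Measure E3}, (∀ w : E3, ‖w‖ ≤ 2 → (μ {w} ≠ 0 ↔ ν {w} ≠ 0)) → (G μ ↔ G ν))
    {c : ℝ} (hc : 0 < c)
    (hprice : ∀ P : Measure (Measure E3), IsProbabilityMeasure P →
      (∀ᵐ μ ∂P, IsRootedHardCore (1 / 3) μ) → IsPointStationaryLaw P →
      eStar + c * (P {μ | ¬ G μ}).toReal ≤ meanRootEnergy P)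
    (Q : PeriodicConfiguration 3) (hsep : ∀ p ∈ Q.points, ∀ q ∈ Q.points, p ≠ q → (1 : ℝ) / 3 ≤ dist p q)
    {t : ℝ}
    (hbad : t * (Q.motif.card : ℝ) ≤ (Nat.card {x : Q.motif //
      ¬ G ((Measure.count : Measure E3).restrict ((fun z => z - (x : E3)) '' Q.points))} : ℝ)) :
    eStar + c * t ≤ Q.energyPerParticle lennardJones := by
  -- it suffices to prove `e* + c·t ≤ e(Q) + ε'` for every `ε' > 0`
  refine le_of_forall_pos_le_add fun ε' hε' => ?_
  have hc1 : 0 < c + 1 := by linarith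
  set ε : ℝ := ε' / (c + 1) with hεdef
  have hε : 0 < ε := div_pos hε' hc1
  have hεε' : (c + 1) * ε = ε' := by rw [hεdef]; field_simp
  -- a block of `Q` with slack `ε`
  obtain ⟨N, hN, y, hy, hysep, hE, hcnt⟩ := exists_blocks hloc Q hsep t hbad hε
  haveI : NeZero N := ⟨hN.ne'⟩
  have hNr : (0 : ℝ) < N := by exact_mod_cast hN
  -- its uniformly rooted law is an admissible test law of the certificate
  have hP : IsProbabilityMeasure (unifRooted y) := isProbabilityMeasure_unifRooted y
  have hcore : ∀ᵐ μ ∂(unifRooted y), IsRootedHardCore (1 / 3) μ := ae_isRootedHardCore_unifRooted hysep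
  have hstat : IsPointStationaryLaw (unifRooted y) := isPointStationaryLaw_unifRooted hy
  have hineq := hprice _ hP hcore hstat
  rw [meanRootEnergy_unifRooted hy] at hineq
  -- energy side: `𝓔_N(y)/N ≤ e(Q) + ε`
  have hEN : interactionEnergy lennardJones y / N ≤ Q.energyPerParticle lennardJones + ε := by
    rw [div_le_iff₀ hNr]
    linarith [hE]
  -- event side: `t − ε ≤ P{¬ G}`
  have hbadP : t - ε ≤ ((unifRooted y) {μ | ¬ G μ}).toReal := by
    have h1 := natCard_le_mul_unifRooted_apply y {μ | ¬ G μ}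
    have h2 : Nat.card {i : Fin N //
          ¬ G ((Measure.count : Measure E3).restrict ((fun z => z - y i) '' Set.range y))} =
        Nat.card {i : Fin N // rootedMeasure y i ∈ {μ | ¬ G μ}} := by
      refine Nat.card_congr (Equiv.subtypeEquivRight fun i => ?_)
      have hset : (fun z => z - y i) '' Set.range y = Set.range fun k => y k - y i := by
        ext w
        simp only [Set.mem_image, Set.mem_range, exists_exists_eq_and]
      rw [Set.mem_setOf_eq, rootedMeasure_eq_range, hset]
    rw [h2] at hcnt
    have h3 : (t - ε) * (N : ℝ) ≤ (N : ℝ) * ((unifRooted y) {μ | ¬ G μ}).toReal := hcnt.trans h1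
    rw [mul_comm] at h3
    exact le_of_mul_le_mul_left h3 hNr
  -- combine
  have h4 : eStar + c * (t - ε) ≤ Q.energyPerParticle lennardJones + ε := by
    have := mul_le_mul_of_nonneg_left hbadP hc.le
    linarith
  calc eStar + c * t = (eStar + c * (t - ε)) + c * ε := by ring
    _ ≤ (Q.energyPerParticle lennardJones + ε) + c * ε := by linarith
    _ = Q.energyPerParticle lennardJones + (c + 1) * ε := by ring
    _ = Q.energyPerParticle lennardJones + ε' := by rw [hεε']

/-! ## The stub -/

/-- **Stub `stub_pricingToPeriodic` of line `octahedral-annulus-mandate`.**  LINEAR PRICING OF A LOCAL SHELL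
PREDICATE OVER POINT-STATIONARY `1/3`-HARD-CORE LAWS IS A PERIODIC CRYSTALLIZATION THEOREM FOR THAT PREDICATE:
for every predicate `G` of measures on `ℝ³` reading only the atoms of `B̄(0, 2)`, every `c > 0` pricing the event
`¬ G` linearly (`e* + c · P{μ | ¬ G μ} ≤ E_P[h]` for all point-stationary, a.s. `1/3`-hard-core probability laws
`P`), every periodic configuration `Q` of `ℝ³` with `1/3`-separated points (`IsSepThird Q`) and every `t` with at
least `t · #motif` motif sites `x` failing `G` at `rerooted Q x`, one has `e* + c · t ≤ e(Q)`
(`le_energyPerParticle_of_pricing`, with `IsSepThird` and `rerooted` unfolded). -/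
theorem stub_pricingToPeriodic :
    ∀ G : Measure E3 → Prop,
      (∀ μ ν : Measure E3, (∀ w : E3, ‖w‖ ≤ 2 → (μ {w} ≠ 0 ↔ ν {w} ≠ 0)) → (G μ ↔ G ν)) →
      ∀ c : ℝ, 0 < c →
      (∀ P : Measure (Measure E3), IsProbabilityMeasure P →
        (∀ᵐ μ ∂P, IsRootedHardCore (1 / 3) μ) → IsPointStationaryLaw P →
        eStar + c * (P {μ | ¬ G μ}).toReal ≤ meanRootEnergy P) →
      ∀ Q : PeriodicConfiguration 3, IsSepThird Q → ∀ t : ℝ,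
        t * (Q.motif.card : ℝ) ≤ (Nat.card {x : Q.motif // ¬ G (rerooted Q (x : E3))} : ℝ) →
        eStar + c * t ≤ Q.energyPerParticle lennardJones := by
  intro G hloc c hc hprice Q hsep t hbad
  unfold IsSepThird at hsep
  unfold rerooted at hbad
  exact le_energyPerParticle_of_pricing (fun h => hloc _ _ h) hc hprice Q hsep hbad

end Summit.AtomisticToContinuum.Crystallization.Theorems.PalmUnimodularRigidityMinimiserShells.PricingToPeriodic

end
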